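import Mathlib
import HarnessLib
import Literature.MathematicalPhysics.StatisticalMechanics.FluctuationKernelComparisonConnTorusFRD
import Literature.MathematicalPhysics.StatisticalMechanics.FluctuationKernelComparisonMidLocalTorusFRD

/-!
# The FIRST-ORDER part of the `ℓ = 2` kernel comparison for a CONNECTED `k`-polymer, volume-uniform:
# `‖fluct C̄ F − fluct 𝒞_{1+q+h,k+1} F‖_{k:k+1,X} ≤ b·((r₀+1)·8q_H·h⁽²⁾_X)·κ^{|X|_k}`,
# `h⁽²⁾_X = (3^{d+1}(2(|X|_k + 2(2^d+R) + 2p_Φ + 1))^d)^{1/2}·(½(Σ|h|)²·K⁽²⁾)` — no dependence on `N`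

The connected-polymer corollary of `tayNormLE_fluct_mid_sub_fluct_local_of_torusFRD` (choice of the auxiliary
scale `N̄` from the diameter of `X*⁺`, exactly as `tayNormLE_fluct_sub_fluct_conn_of_torusFRD` does for
`ℓ = 1`).  This is the form consumed by the operator slots (`B_k`, single blocks) of the `ℓ = 2` family.

* **`tayNormLE_fluct_mid_sub_fluct_conn_of_torusFRD`**.

## References
* S. Adams, S. Buchholz, R. Kotecký, S. Müller, arXiv:1910.13564, Lemma 8.4, Lemma 12.6
  [AdamsBuchholzKoteckyMuller2019].
* S. Buchholz, J. Funct. Anal. 275 (2018), Thm 4.5 [Buchholz2016].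
-/

noncomputable section

namespace Literature.MathematicalPhysics.StatisticalMechanics.GradientRG

open scoped BigOperators
open Real Set Finset MeasureTheory
open Literature.MathematicalPhysics.StatisticalMechanics.GradientFRD
  (fourierCoeff cExt cExt_of_mem IsElliptic IsUnitSymm InShell iterDiff supNorm conv ellOp isElliptic_one)
open Literature.MathematicalPhysics.StatisticalMechanics.TorusPolymer
  (IsPolymer numBlocks thicken blocks mem_thicken card_blocks_eq_numBlocks supNorm_sub_le supNorm_sub_comm
    supNorm_sub_lt_of_isConn)
open Literature.Barriers.CriticalPhenomena.LongRangePhi4.Polymer (IsConn)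
open Literature.MathematicalPhysics.QuantumFieldTheory

variable {d M : ℕ} [NeZero M]

section Package

variable {L N Mord R n ñ : ℕ} {θbar lam μ δ₁ δ₀ A𝒫 : ℝ}
    {𝒞 : Matrix (Fin d) (Fin d) ℝ → ℕ → (Fin d → ZMod M) → ℝ} {Mc : ℕ → ℝ}
    {Cα : (Fin d → ℕ) → ℕ → ℝ} {c C : ℝ} {Cℓ : ℕ → ℝ}

set_option maxHeartbeats 3200000 in
/-- **First-order part of the `ℓ = 2` comparison for a CONNECTED `k`-polymer, volume-uniform**: for one
`TorusFRD` package with the gap `d + 1 ≤ 2(ñ−n)` on `(ℤ/L^N)^d`, symmetric `q`, `h` with `q, q+h, q+2h` in the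
ball `Σ|·| ≤ T₀` (`T₀ ≤ ½`, `K T₀ ≤ log(1+ρ)`, `ρ < θ̄`), Hölder conjugates `p, q_H` with `p(1+ρ) ≤ 1+ρ''`,
`k + 1 ≤ N`, a CONNECTED `k`-polymer `X` and a `T_k^{X*}`-local `C^{r₀}` functional `F` with `‖F‖_{k,X} ≤ b`:
`‖fluct C̄ F − fluct 𝒞_{1+q+h,k+1} F‖_{k:k+1,X} ≤ b·((r₀+1)·8q_H·h⁽²⁾_X)·κ^{|X|_k}` with
`h⁽²⁾_X = (3^{d+1}(2(|X|_k + 2(2^d+R) + 2p_Φ + 1))^d)^{1/2}·(½(Σ|h|)²·K⁽²⁾)`, `C̄ = ½(𝒞_{1+q,k+1}+𝒞_{1+q+2h,k+1})`.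
[cite: AdamsBuchholzKoteckyMuller2019, Lemma 8.4 / Lemma 12.6] -/
theorem tayNormLE_fluct_mid_sub_fluct_conn_of_torusFRD
    (hd : 3 ≤ d) (hMord : 1 ≤ Mord) (hMR : Mord ≤ R) (hLodd : Odd L) (hL : 2 ^ (d + 3) + 16 * R ≤ L)
    (hM : M = L ^ N)
    (hθbar : 0 < θbar) (hlam : 0 < lam) (hn : 2 * Mord ≤ n) (hn2 : 2 ≤ n) (hnñ : n ≤ ñ)
    (hgap : d + 1 ≤ 2 * (ñ - n))
    (hc : 0 < c) (hC1 : 0 ≤ Cℓ 1) (hC2 : 0 ≤ Cℓ 2)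
    (hallA : ∀ A : Matrix (Fin d) (Fin d) ℝ, IsElliptic (1 / 2 : ℝ) 2 A →
        (∀ k, 1 ≤ k → k ≤ N + 1 →
          ∑ x : Fin d → ZMod M, 𝒞 A k x = 0 ∧ ∀ x, 𝒞 A k (-x) = 𝒞 A k x) ∧
        (∀ k, 1 ≤ k → k ≤ N + 1 → ∀ φ : (Fin d → ZMod M) → ℝ, ∑ x, φ x = 0 →
          0 ≤ ∑ x, ∑ y, φ x * 𝒞 A k (x - y) * φ y) ∧
        (∀ φ : (Fin d → ZMod M) → ℝ, ∑ x, φ x = 0 →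
          ellOp A (conv (fun x => ∑ k ∈ Finset.Icc 1 (N + 1), 𝒞 A k x) φ) = φ) ∧
        (∀ k, 1 ≤ k → k ≤ N → Mc k ≤ 0 ∧
          ∀ x : Fin d → ZMod M, ((L : ℝ) ^ k) / 2 ≤ (supNorm x : ℝ) →
            𝒞 A k x = Mc k) ∧
        (∀ k, 1 ≤ k → k ≤ N + 1 → ∀ B : Matrix (Fin d) (Fin d) ℝ, IsUnitSymm B →
          (∃ ε : ℝ, 0 < ε ∧ ∀ x : Fin d → ZMod M,
            ContDiffOn ℝ ⊤ (fun s : ℝ => 𝒞 (A + s • B) k x) (Set.Ioo (-ε) ε)) ∧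
          ∀ α : Fin d → ℕ, ∑ i, α i ≤ n → ∀ ℓ : ℕ, ∀ x : Fin d → ZMod M,
            abs (iteratedDeriv ℓ (fun s : ℝ => iterDiff α (𝒞 (A + s • B) k) x) 0)
              ≤ Cα α ℓ / (L : ℝ) ^ ((k - 1) * (d - 2 + ∑ i, α i))) ∧
        (∀ k, 1 ≤ k → k ≤ N + 1 → ∀ j : ℕ, ∀ κ : Fin d → ZMod M, κ ≠ 0 → InShell L j κ →
          (j < k →
            c / (L : ℝ) ^ (2 * (d + ñ) + 1) * (L : ℝ) ^ (2 * j)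
                / (L : ℝ) ^ ((k - j) * (d - 1 + n)) ≤ (fourierCoeff (𝒞 A k) κ).re ∧
            ‖fourierCoeff (𝒞 A k) κ‖
              ≤ C * (L : ℝ) ^ (2 * (d + ñ) + 1) * (L : ℝ) ^ (2 * j)
                  / (L : ℝ) ^ ((k - j) * (d - 1 + n))) ∧
          (k ≤ j →
            c / (L : ℝ) ^ (2 * (d + ñ) + 1) * (L : ℝ) ^ (2 * k)
                ≤ (fourierCoeff (𝒞 A k) κ).re ∧
            ‖fourierCoeff (𝒞 A k) κ‖ ≤ C * (L : ℝ) ^ (2 * k)) ∧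
          ∀ B : Matrix (Fin d) (Fin d) ℝ, IsUnitSymm B → ∀ ℓ : ℕ, 1 ≤ ℓ →
            (j < k →
              ‖iteratedDeriv ℓ (fun s : ℝ => fourierCoeff (𝒞 (A + s • B) k) κ) 0‖
                ≤ Cℓ ℓ * (L : ℝ) ^ (2 * (d + ñ) + 1) * (L : ℝ) ^ (2 * j)
                    / (L : ℝ) ^ ((k - j) * (d - 1 + ñ))) ∧
            (k ≤ j →
              ‖iteratedDeriv ℓ (fun s : ℝ => fourierCoeff (𝒞 (A + s • B) k) κ) 0‖
                ≤ Cℓ ℓ * (L : ℝ) ^ (2 * k))))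
    (hB : AbkmWeightBounds L N Mord R n θbar lam μ δ₁ δ₀ A𝒫 (fun j => 𝒞 1 j)
      (abkmWeightData L N Mord R θbar (schedDelta δ₀ δ₁ N) fun j => 𝒞 1 j))
    {k : ℕ} (hkN : k + 1 ≤ N) {ρ : ℝ} (hρ0 : 0 ≤ ρ) (hρ : ρ < θbar)
    {T₀ : ℝ} (hT₀ : T₀ ≤ 1 / 2) (hKT₀ : shellRatioConst c (Cℓ 1) (L : ℝ) d ñ * T₀ ≤ Real.log (1 + ρ))
    {q y : Matrix (Fin d) (Fin d) ℝ} (hq : q.IsSymm) (hh : y.IsSymm)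
    (hqT : ∑ i, ∑ j, |q i j| ≤ T₀) (hqhT : ∑ i, ∑ j, |(q + y) i j| ≤ T₀)
    (hq2hT : ∑ i, ∑ j, |(q + (2 : ℝ) • y) i j| ≤ T₀)
    {p qH ρ'' : ℝ} (hpq : p.HolderConjugate qH) (hρ''0 : 0 ≤ ρ'') (hρ'' : ρ'' < θbar)
    (hpρ : p * (1 + ρ) ≤ 1 + ρ'')
    {pT r₀ : ℕ} {h A : ℝ} {X : Finset (Fin d → ZMod M)} (hX : IsPolymer (L ^ k) X) (hXc : IsConn X)
    {F : ((Fin d → ZMod M) → ℝ) → ℂ} {b : ℝ} (hb : 0 ≤ b) (hFd : ContDiff ℝ r₀ F)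
    (hFloc : IsGaugeLocal ((abkmNormParams L N Mord R pT r₀ h θbar A (schedDelta δ₀ δ₁ N)
      fun j => 𝒞 1 j).gauge k X) F)
    (hF : TayNormLE ((abkmNormParams L N Mord R pT r₀ h θbar A (schedDelta δ₀ δ₁ N) fun j => 𝒞 1 j).gauge k X)
      r₀ ((abkmWeightData L N Mord R θbar (schedDelta δ₀ δ₁ N) fun j => 𝒞 1 j).weight k X) F b) :
    TayNormLE ((abkmNormParams L N Mord R pT r₀ h θbar A (schedDelta δ₀ δ₁ N) fun j => 𝒞 1 j).gauge k X) r₀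
      ((abkmWeightData L N Mord R θbar (schedDelta δ₀ δ₁ N) fun j => 𝒞 1 j).midWeight k X)
      (fluct (fun x => 2⁻¹ * 𝒞 ((1 : Matrix (Fin d) (Fin d) ℝ) + q) (k + 1) x +
          2⁻¹ * 𝒞 ((1 : Matrix (Fin d) (Fin d) ℝ) + (q + (2 : ℝ) • y)) (k + 1) x) F -
        fluct (𝒞 ((1 : Matrix (Fin d) (Fin d) ℝ) + (q + y)) (k + 1)) F)
      (b * ((r₀ + 1) * (8 * qH *
          (Real.sqrt ((3 : ℝ) ^ (d + 1) * ((2 * (numBlocks (L ^ k) X + 2 * (2 ^ d + R) + 2 * pT + 1) : ℕ) : ℝ) ^ d) *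
            (2⁻¹ * (∑ i, ∑ j, |y i j|) ^ 2 * shellRatioConst c (Cℓ 2) (L : ℝ) d ñ)))) *
        (weightIntConstRho θbar ρ'' (traceConst d Mord R lam (derivSum d n fun θ' _ => Cα θ' 0)) ^ (1 / p)) ^
          numBlocks (L ^ k) X) := by
  have h8 : 8 ≤ 2 ^ (d + 3) := by
    calc 8 = 2 ^ 3 := by norm_num
      _ ≤ 2 ^ (d + 3) := Nat.pow_le_pow_right (by norm_num) (by omega)
  have hL2 : 2 ≤ L := by omega
  have hL1 : 1 ≤ L := by omega
  have hL1r : (1 : ℝ) ≤ (L : ℝ) := by exact_mod_cast hL1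
  -- the number of blocks and the diameter scale `D₀`
  set m := numBlocks (L ^ k) X with hmdef
  set D₀ : ℕ := m + 2 * (2 ^ d + R) + 2 * pT + 1 with hD₀
  have hD₀pos : 1 ≤ D₀ := by omega
  -- the auxiliary scale: `t = log_L (2 D₀) + 1`, `N̄ = min N (k + t)`
  set t : ℕ := Nat.log L (2 * D₀) + 1 with htdef
  have ht1 : 1 ≤ t := by omega
  have hLt : 2 * D₀ < L ^ t := by rw [htdef]; exact Nat.lt_pow_succ_log_self (by omega) _
  have hLt' : L ^ (t - 1) ≤ 2 * D₀ := by
    rw [htdef, Nat.add_sub_cancel]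
    exact Nat.pow_log_le_self L (by omega)
  set Nb : ℕ := min N (k + t) with hNbdef
  have hNbk : k + 1 ≤ Nb := le_min hkN (by omega)
  have hNbN : Nb ≤ N := min_le_left _ _
  -- the diameter of `X*⁺`
  have hdiamX : ∀ x ∈ X, ∀ y ∈ X, supNorm (x - y) + 1 ≤ m * L ^ k := by
    intro x hx y hy
    have := supNorm_sub_lt_of_isConn (s := L ^ k) hLodd.pow hXc le_rfl hx hy
    rwa [card_blocks_eq_numBlocks] at this
  have hrad : starRad R L d k ≤ (2 ^ d + R) * L ^ k := starRad_le hL1 d k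
  have hpT : pT ≤ pT * L ^ k := Nat.le_mul_of_pos_right _ (Nat.one_le_pow _ _ (by omega))
  have hdiam' : ∀ x' ∈ thicken pT (thicken (starRad R L d k) X), ∀ y' ∈ thicken pT (thicken (starRad R L d k) X),
      supNorm (x' - y') + 1 ≤ D₀ * L ^ k := by
    intro x' hx' y' hy'
    obtain ⟨x, hx, y, hy, hle⟩ := supNorm_sub_le_of_mem_thicken_thicken hx' hy'
    have h1 := hdiamX x hx y hy
    have h2 : D₀ * L ^ k = m * L ^ k + 2 * ((2 ^ d + R) * L ^ k) + 2 * (pT * L ^ k) + L ^ k := by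
      rw [hD₀]; ring
    have h3 : 1 ≤ L ^ k := Nat.one_le_pow _ _ (by omega)
    omega
  have hdiam : ∀ x' ∈ thicken pT (thicken (starRad R L d k) X), ∀ y' ∈ thicken pT (thicken (starRad R L d k) X),
      supNorm (x' - y') ≤ L ^ Nb / 2 := by
    intro x' hx' y' hy'
    rcases le_or_gt N (k + t) with hN | hN
    · -- `N̄ = N`: everything is within `M/2`
      have hNb : Nb = N := min_eq_left hN
      rw [hNb, ← hM]
      exact supNorm_le_half _
    · have hNb : Nb = k + t := min_eq_right hN.le
      rw [hNb]
      have h1 := hdiam' x' hx' y' hy'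
      have h2 : 2 * (D₀ * L ^ k) ≤ L ^ (k + t) := by
        have h3 : 2 * D₀ * L ^ k ≤ L ^ t * L ^ k := Nat.mul_le_mul_right _ hLt.le
        calc 2 * (D₀ * L ^ k) = 2 * D₀ * L ^ k := by ring
          _ ≤ L ^ t * L ^ k := h3
          _ = L ^ (k + t) := by rw [← pow_add, Nat.add_comm t k]
      omega
  -- the local estimate at the auxiliary scale
  have hloc := tayNormLE_fluct_mid_sub_fluct_local_of_torusFRD hd hMord hMR hLodd hL hM hθbar hlam hn hn2 hnñ hgap hc
    hC1 hC2 hallA hB hρ0 hρ hT₀ hKT₀ hq hh hqT hqhT hq2hT hpq hρ''0 hρ'' hpρ hX hNbk hNbN hdiam hb hFd hFloc hF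
    (pT := pT) (r₀ := r₀) (h := h) (A := A)
  -- `L^{(N̄ − (k+1))d} ≤ (2 D₀)^d`
  have hexp : (L : ℝ) ^ ((Nb - (k + 1)) * d) ≤ ((2 * D₀ : ℕ) : ℝ) ^ d := by
    have h1 : Nb - (k + 1) ≤ t - 1 := by omega
    have h2 : L ^ (Nb - (k + 1)) ≤ 2 * D₀ := (Nat.pow_le_pow_right hL1 h1).trans hLt'
    have h3 : (L : ℝ) ^ (Nb - (k + 1)) ≤ ((2 * D₀ : ℕ) : ℝ) := by exact_mod_cast h2
    rw [pow_mul]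
    exact pow_le_pow_left₀ (by positivity) h3 d
  -- monotonicity of the constant
  have hK0 : 0 ≤ shellRatioConst c (Cℓ 2) (L : ℝ) d ñ := shellRatioConst_nonneg hc hC2 (Nat.cast_nonneg _) d ñ
  have hT0 : 0 ≤ ∑ i, ∑ j, |y i j| := sum_nonneg fun _ _ => sum_nonneg fun _ _ => abs_nonneg _
  have hA𝒫p : 0 ≤ weightIntConstRho θbar ρ'' (traceConst d Mord R lam (derivSum d n fun θ' _ => Cα θ' 0)) :=
    zero_le_one.trans (one_le_weightIntConstRho hθbar hρ''0 hρ''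
      (traceConst_nonneg d Mord R hlam.le (derivSum_nonneg d n _)))
  have hsqrt : Real.sqrt ((3 : ℝ) ^ (d + 1) * (L : ℝ) ^ ((Nb - (k + 1)) * d)) ≤
      Real.sqrt ((3 : ℝ) ^ (d + 1) * ((2 * D₀ : ℕ) : ℝ) ^ d) :=
    Real.sqrt_le_sqrt (mul_le_mul_of_nonneg_left hexp (by positivity))
  have hD₀cast : ((2 * D₀ : ℕ) : ℝ) = ((2 * (numBlocks (L ^ k) X + 2 * (2 ^ d + R) + 2 * pT + 1) : ℕ) : ℝ) := by
    rw [hD₀]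
  rw [hD₀cast] at hsqrt
  refine hloc.mono ?_ (fun φ => ((abkmWeightData L N Mord R θbar (schedDelta δ₀ δ₁ N) fun j => 𝒞 1 j).midWeight_pos k X φ).le)
  have hwpos : 0 ≤ (weightIntConstRho θbar ρ'' (traceConst d Mord R lam (derivSum d n fun θ' _ => Cα θ' 0)) ^ (1 / p)) ^
      numBlocks (L ^ k) X := pow_nonneg (Real.rpow_nonneg hA𝒫p _) _
  refine mul_le_mul_of_nonneg_right (mul_le_mul_of_nonneg_left ?_ hb) hwpos
  refine mul_le_mul_of_nonneg_left ?_ (by positivity)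
  refine mul_le_mul_of_nonneg_left ?_ (by linarith [hpq.symm.lt])
  exact mul_le_mul_of_nonneg_right hsqrt (by positivity)

end Package

end Literature.MathematicalPhysics.StatisticalMechanics.GradientRG

end
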